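import Summits.AtomisticToContinuum.Crystallization.Theses.ThreeConeCertificate

/-!
# Route `ThreeConeCertificate`, item `EnergeticHalf` (stmt-AtomisticToContinuum-11964)

The purely soft glue step of the route: the Kepler bound for Lennard-Jones
(`KeplerBound`: some periodic `P` has `N·e(P) ≤ 𝓔_N(x)` for every `N` and every injective
configuration `x`) together with the trial-state upper bound (`TrialStateUpper`: for every
periodic `Q` and `ε > 0`, eventually `E(N)/N ≤ e(Q) + ε`) gives conjunct (i) of
`Crystallization`, `HasPeriodicGroundStateEnergy lennardJones 3`, with the SAME `P`:

* `e(P) ≤ E(N)/N` for `N ≥ 1` (`le_ciInf` over the non-empty type of injective configurations,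
  `nonempty_injective_config`);
* `e(P) ≤ e(Q)` for every periodic `Q` (`le_of_forall_pos_le_add`: pick `N ≥ 1` in the
  eventual set of `TrialStateUpper Q ε`), so `e(P)` is the least element of the range;
* `E(N)/N → e(P)` by the order-topology squeeze (`tendsto_order`): the lower bound above and
  `TrialStateUpper` at `Q = P` with `ε = (b - e(P))/2`.

All `[folklore]` (Blanc–Lewin 2015, §1.3 (8) / §2.1 for the shape of the statement).
-/

namespace Summit.AtomisticToContinuum.Crystallization.Theorems

open Literature.MathematicalPhysics.StatisticalMechanics
open Summit.AtomisticToContinuum.Crystallization.Theses.ThreeConeCertificate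
open Filter Topology

/-- **Lower bound from the Kepler bound.** If `N·e ≤ 𝓔_N(x)` for every injective configuration
`x` of `N ≥ 1` points of `ℝ³`, then `e ≤ E(N)/N` (the infimum defining `E(N)` runs over a
non-empty type, `nonempty_injective_config`). [folklore] -/
theorem le_groundStateEnergy_div_of_forall_le {V : ℝ → ℝ} {e : ℝ} {N : ℕ} (hN : 1 ≤ N)
    (h : ∀ x : Fin N → EuclideanSpace ℝ (Fin 3), Function.Injective x →
      (N : ℝ) * e ≤ interactionEnergy V x) :
    e ≤ groundStateEnergy V 3 N / N := by
  have hNpos : (0 : ℝ) < N := by exact_mod_cast hN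
  rw [le_div_iff₀ hNpos, mul_comm]
  haveI := nonempty_injective_config (d := 3) (by norm_num) N
  exact le_ciInf fun x => h x.1 x.2

/-- **`EnergeticHalf` holds** (item stmt-AtomisticToContinuum-11964 of route
`ThreeConeCertificate`): `KeplerBound → TrialStateUpper → HasPeriodicGroundStateEnergy
lennardJones 3`. With `P` from `KeplerBound`: `e(P) ≤ E(N)/N` for `N ≥ 1`; `e(P) ≤ e(Q) + ε`
for all `Q`, `ε > 0` by `TrialStateUpper` at an eventual `N ≥ 1`, so `e(P)` is least;
`E(N)/N → e(P)` by squeezing between the lower bound and `TrialStateUpper` at `Q = P`.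
[folklore] -/
theorem energeticHalf_proof : EnergeticHalf := by
  unfold EnergeticHalf KeplerBound TrialStateUpper
  rintro ⟨P, hP⟩ hT
  -- lower bound `e(P) ≤ E(N)/N` for `N ≥ 1`
  have hlow : ∀ N : ℕ, 1 ≤ N →
      P.energyPerParticle lennardJones ≤ groundStateEnergy lennardJones 3 N / N :=
    fun N hN => le_groundStateEnergy_div_of_forall_le hN (hP N)
  -- `e(P) ≤ e(Q)` for every periodic `Q`
  have hle : ∀ Q : PeriodicConfiguration 3,
      P.energyPerParticle lennardJones ≤ Q.energyPerParticle lennardJones := by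
    intro Q
    refine le_of_forall_pos_le_add fun ε hε => ?_
    obtain ⟨N, hN₁, hN₂⟩ := ((hT Q ε hε).and (eventually_ge_atTop 1)).exists
    exact (hlow N hN₂).trans hN₁
  refine ⟨P, ⟨⟨P, rfl⟩, ?_⟩, ?_⟩
  · rintro _ ⟨Q, rfl⟩
    exact hle Q
  · rw [tendsto_order]
    refine ⟨fun a ha => ?_, fun b hb => ?_⟩
    · filter_upwards [eventually_ge_atTop 1] with N hN
      exact lt_of_lt_of_le ha (hlow N hN)
    · have hε : 0 < (b - P.energyPerParticle lennardJones) / 2 := by linarith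
      filter_upwards [hT P _ hε] with N hN
      linarith

end Summit.AtomisticToContinuum.Crystallization.Theorems
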